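import Summits.ResolutionOfSingularities.ResolutionOfSingularities.Theorems.EquisingularLiftEquisingularLiftNatCarrierDeltaOffVertex
import HarnessLib

/-!
# [OURS · L1 W4.5(b) · EL♮(3)] (δ) D5 sub-brick: the Δ-centre `St_τ(K) ⊔ E` on a given chart presentation with the Δ-criterion
# required only OFF FINITELY MANY COORDINATE PRIMES of that chart (POINTED form of res-type-100's F3b′ / res-L1-w45b-stub-2's B5 chart lemma)

Crux chain w45b (cell `res-hironaka`, slot W4.5(b)), working crux **EL♮** = stmt-ResolutionOfSingularities-20038, child **EL♮(3)** =
stmt-ResolutionOfSingularities-20148, route EquisingularLift, line `sections`, registered stub `stub_elnat_tcPlusPlusPointResolution` (v2);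
brick **(δ) D5 MEMBER_S**, clause (v) «regular quotient stalks of codimension 2 at the special points NOT over `S`» (res-L1-w45b-stub-3
`DELTA-PLAN.md`; res-L1-w45b-plan-1 BOOKING 2026-08-27T16:20:41Z: D5/D6 := res-type-100). HONEST FRAMING: OURS; NOT a statement of any
manuscript; AI-written, weaker than expert review. No `sorry`; standard axioms. DEF-FREE. `--supports stmt-ResolutionOfSingularities-20148 --as helper`.

WHY. For the member CENTRED AT A SUB-CLUSTER `S`, res-L1-w45b-stub-3's D1 (`exists_clusterConeLift_subset`, p548257) delivers the Δ-criterion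
on the chart `T_j = 1` at every prime over `ϖ` EXCEPT the point ideals of the `S`-points and of the other-chart cluster points. F3b′
(`isRegularLocalRing_stalk_quotient_carrierDelta_of_presentation`, p535966) and its prescribed-chart corollary (res-L1-w45b-stub-2,
…NatCarrierDeltaOffVertex) ask the criterion at EVERY prime over `ϖ`, although the proof reads it at ONE prime — the image of the
presentation prime `𝔔`. This file threads the exclusions through: the criterion is asked only at primes avoiding a family of COORDINATE
primes `(T_l − β_e l : l ≠ j)`, and the point `x′` is asked NOT to be the corresponding coordinate point (`¬ ∀ l, χ(c_l/c_j) − τ♯ b_e l ∈ 𝔪_{x′}`,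
`θ b̄_e = β_e`).

WHAT (namespace `…Cruxes.EquisingularLiftNat.Sections`).
* `isRegularLocalRing_localization_map_of_deltaCriterion_pointed` — ring-level transport (F3b′'s, pointed).
* `isRegularLocalRing_stalk_quotient_carrierDelta_of_presentation_pointed` — F3b′ pointed.
* `isRegularLocalRing_stalk_quotient_carrierDelta_of_generator_pointed` — res-L1-w45b-stub-2's «clause (v) on a good chart», pointed.

References: res-type-100 …NatCarrierDeltaOfPresentation (p535966), …NatCarrierDeltaRegular (p513634), …NatConeChart (p508912);
res-L1-w45b-stub-2 …NatCarrierDeltaOffVertex; H. Matsumura, *Commutative Ring Theory*, Thm. 14.2 [cite: Matsumura1987, Thm. 14.2].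
-/

set_option linter.dupNamespace false -- mandated namespace `Summit.<Summit>.<Problem>` of this single-conjunct summit

noncomputable section

open CategoryTheory CategoryTheory.Limits AlgebraicGeometry TopologicalSpace IsLocalRing
open Literature.AlgebraicGeometry.Resolution
open AlgebraicGeometry.Scheme.IdealSheafData

namespace Summit.ResolutionOfSingularities.ResolutionOfSingularities.Cruxes.EquisingularLiftNat.Sections

universe u

/-! ## 1. Ring level -/

section RingLevel

variable {R : Type u} [CommRing R] {r : ℕ} (c : Fin r → R) (j : Fin r)

/-- **Transport of the POINTED Δ-criterion.** As `isRegularLocalRing_localization_map_of_deltaCriterion` (p513634): `θ : R/(c) ≅ Λ`,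
`ε₀ : B/𝔞 ≅ (R/(c))[T_l : l ≠ j]/(Φ̄_j)` with `ε₀ [bC r] = [C r̄]`, `ε₀ [bX l] = [T_l]`; the criterion on `Λ[T]/(Φ̄_j^θ)` is asked only at
primes `𝔓 ∋ C(θ ϖ̄_R)` that do NOT contain a whole coordinate family `(T_l − β_e l)_l`; and the prime `𝔔 ⊇ 𝔞`, `𝔔 ∋ bC ϖ_R`, is asked
not to contain a whole family `(bX l − bC (b_e l))_l` with `θ b̄_e = β_e`. Then `(B/𝔞)_{𝔔/𝔞}` is regular. [folklore] -/
theorem isRegularLocalRing_localization_map_of_deltaCriterion_pointed (Φ : MvPolynomial (Fin r) R) (ϖR : R)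
    {Λ : Type u} [CommRing Λ] (θ : (R ⧸ Ideal.span (Set.range c)) ≃+* Λ) {ι : Type*}
    (β : ι → {l : Fin r // l ≠ j} → Λ)
    (hreg : ∀ (𝔓 : Ideal (MvPolynomial {l : Fin r // l ≠ j} Λ ⧸ Ideal.span {MvPolynomial.map
        (θ.toRingHom.comp (Ideal.Quotient.mk (Ideal.span (Set.range c)))) (dehomogenize j Φ)})) [𝔓.IsPrime],
      Ideal.Quotient.mk _ (MvPolynomial.C (θ (Ideal.Quotient.mk _ ϖR))) ∈ 𝔓 →
      (∀ e, ¬ ∀ l, Ideal.Quotient.mk _ (MvPolynomial.X l - MvPolynomial.C (β e l)) ∈ 𝔓) →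
        IsRegularLocalRing (Localization.AtPrime 𝔓))
    {B : Type u} [CommRing B] (𝔞 : Ideal B) (bC : R → B) (bX : {l : Fin r // l ≠ j} → B)
    (ε₀ : (B ⧸ 𝔞) ≃+* (MvPolynomial {l : Fin r // l ≠ j} (R ⧸ Ideal.span (Set.range c)) ⧸
      Ideal.span {MvPolynomial.map (Ideal.Quotient.mk (Ideal.span (Set.range c))) (dehomogenize j Φ)}))
    (hε₀C : ∀ a, ε₀ (Ideal.Quotient.mk 𝔞 (bC a)) =
      Ideal.Quotient.mk _ (MvPolynomial.C (Ideal.Quotient.mk (Ideal.span (Set.range c)) a)))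
    (hε₀X : ∀ l, ε₀ (Ideal.Quotient.mk 𝔞 (bX l)) = Ideal.Quotient.mk _ (MvPolynomial.X l))
    (𝔔 : Ideal B) [(𝔔.map (Ideal.Quotient.mk 𝔞)).IsPrime] (hb₀ : bC ϖR ∈ 𝔔) (h𝔞𝔔 : 𝔞 ≤ 𝔔)
    (b : ι → {l : Fin r // l ≠ j} → R) (hb : ∀ e l, θ (Ideal.Quotient.mk _ (b e l)) = β e l)
    (hexcl : ∀ e, ¬ ∀ l, bX l - bC (b e l) ∈ 𝔔) :
    IsRegularLocalRing (Localization.AtPrime (𝔔.map (Ideal.Quotient.mk 𝔞))) := by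
  -- `(R/(c))[T]/(Φ̄_j) ≅ Λ[T]/(Φ̄_j^θ)` along `θ` (verbatim from p513634)
  let μ : MvPolynomial {l : Fin r // l ≠ j} (R ⧸ Ideal.span (Set.range c)) ≃+*
      MvPolynomial {l : Fin r // l ≠ j} Λ := MvPolynomial.mapEquiv {l : Fin r // l ≠ j} θ
  have hμ : ∀ F, μ F = MvPolynomial.map (θ : _ →+* Λ) F := fun F => rfl
  have hμspan : Ideal.span {MvPolynomial.map (θ.toRingHom.comp (Ideal.Quotient.mk (Ideal.span (Set.range c))))
      (dehomogenize j Φ)} = (Ideal.span {MvPolynomial.map (Ideal.Quotient.mk (Ideal.span (Set.range c)))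
        (dehomogenize j Φ)}).map (μ : _ →+* _) := by
    rw [Ideal.map_span, Set.image_singleton]
    change _ = Ideal.span {μ _}
    rw [hμ, MvPolynomial.map_map]
    rfl
  let ε' := Ideal.quotientEquiv _ _ μ hμspan
  let ε'' := ε₀.trans ε'
  obtain ⟨e₃⟩ := nonempty_ringEquiv_localization_atPrime_comap_symm ε'' (𝔔.map (Ideal.Quotient.mk 𝔞))
  -- images of constants and of the chart coordinates under `ε'' ∘ mk_𝔞`
  have hC : ∀ a, ε'' (Ideal.Quotient.mk 𝔞 (bC a)) = Ideal.Quotient.mk _ (MvPolynomial.C (θ (Ideal.Quotient.mk _ a))) := by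
    intro a
    change ε' (ε₀ _) = _
    rw [hε₀C]
    change Ideal.quotientEquiv _ _ μ hμspan (Ideal.Quotient.mk _ _) = _
    rw [Ideal.quotientEquiv_mk]
    change Ideal.Quotient.mk _ (μ _) = _
    rw [hμ, MvPolynomial.map_C]
    rfl
  have hX : ∀ l, ε'' (Ideal.Quotient.mk 𝔞 (bX l)) = Ideal.Quotient.mk _ (MvPolynomial.X l) := by
    intro l
    change ε' (ε₀ _) = _
    rw [hε₀X]
    change Ideal.quotientEquiv _ _ μ hμspan (Ideal.Quotient.mk _ _) = _
    rw [Ideal.quotientEquiv_mk]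
    change Ideal.Quotient.mk _ (μ _) = _
    rw [hμ, MvPolynomial.map_X]
  -- membership in `𝔓 := ε''(𝔔/𝔞)` pulls back to membership in `𝔔`
  have hback : ∀ y : B, ε'' (Ideal.Quotient.mk 𝔞 y) ∈ (𝔔.map (Ideal.Quotient.mk 𝔞)).comap ε''.symm.toRingHom ↔ y ∈ 𝔔 := by
    intro y
    rw [Ideal.mem_comap]
    change ε''.symm (ε'' _) ∈ _ ↔ _
    rw [RingEquiv.symm_apply_apply]
    constructor
    · intro h
      have h' : y ∈ (𝔔.map (Ideal.Quotient.mk 𝔞)).comap (Ideal.Quotient.mk 𝔞) := h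
      rwa [Ideal.comap_map_of_surjective _ Ideal.Quotient.mk_surjective, ← RingHom.ker_eq_comap_bot, Ideal.mk_ker,
        sup_eq_left.mpr h𝔞𝔔] at h'
    · exact fun h => Ideal.mem_map_of_mem _ h
  -- `C(θ ϖ̄_R) ∈ 𝔓`
  have hmem : Ideal.Quotient.mk _ (MvPolynomial.C (θ (Ideal.Quotient.mk _ ϖR))) ∈
      (𝔔.map (Ideal.Quotient.mk 𝔞)).comap ε''.symm.toRingHom := by
    rw [← hC]; exact (hback _).mpr hb₀
  -- `𝔓` avoids the excluded coordinate families
  have hexcl' : ∀ e, ¬ ∀ l, Ideal.Quotient.mk _ (MvPolynomial.X l - MvPolynomial.C (β e l)) ∈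
      (𝔔.map (Ideal.Quotient.mk 𝔞)).comap ε''.symm.toRingHom := by
    intro e hall
    apply hexcl e
    intro l
    have h1 : ε'' (Ideal.Quotient.mk 𝔞 (bX l - bC (b e l))) =
        Ideal.Quotient.mk _ (MvPolynomial.X l - MvPolynomial.C (β e l)) := by
      rw [map_sub, map_sub, hX, hC, hb, map_sub]
    exact (hback _).mp (h1 ▸ hall l)
  haveI := hreg _ hmem hexcl'
  exact IsRegularLocalRing.of_ringEquiv e₃.symm

end RingLevel

/-! ## 2. Scheme level: F3b′ pointed, and its prescribed-chart corollary -/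

section SchemeLevel

variable {X X' : Scheme.{u}} {τ : X' ⟶ X} {J : X.IdealSheafData}

set_option maxHeartbeats 400000 in -- the chart algebra `blowupAlgebra` is a subalgebra of a localisation: slow instance unification (cf. p535966)
/-- **F3b′ POINTED.** Setting of res-type-100's `isRegularLocalRing_stalk_quotient_carrierDelta_of_presentation` (p535966): a presentation
`(j, 𝔔, χ)` of `𝒪_{X',x'}`, `x' ∈ supp (St_τ(K) ⊔ E)`, `ϖ_R = v_p ∈ 𝔪_p`, `θ : R/(c) ≅ Λ`. IF the Δ-criterion holds at every prime of
`Λ[T_l : l ≠ j]/(Φ̄_j^θ)` containing `C(θ ϖ̄_R)` and NOT containing a whole coordinate family `(T_l − β_e l)_l` (`e ∈ ι`), AND `x'` is not a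
coordinate point `b_e` of the chart (`¬ ∀ l, χ(c_l/c_j) − τ♯(b_e l) ∈ 𝔪_{x'}`, `θ b̄_e = β_e`), THEN `𝒪_{X',x'} ⧸ (St K ⊔ E)_{x'}` is a regular
local ring. [cite: Matsumura1987, Thm. 14.2] -/
theorem isRegularLocalRing_stalk_quotient_carrierDelta_of_presentation_pointed [IsLocallyNoetherian X']
    (K : X.IdealSheafData) (x' : X') (p : X) (hp : τ x' = p) (hpJ : p ∈ (J.support : Set X)) {r : ℕ}
    (c : Fin r → X.presheaf.stalk p) (hcJ : Ideal.span (Set.range c) = stalkIdeal J p)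
    (hc : IsQuasiRegular c) [IsDomain (X.presheaf.stalk p ⧸ Ideal.span (Set.range c))]
    {d : ℕ} (Φ : MvPolynomial (Fin r) (X.presheaf.stalk p)) (hΦd : Φ.IsHomogeneous d)
    (hΦ : MvPolynomial.map (Ideal.Quotient.mk (Ideal.span (Set.range c))) Φ ≠ 0)
    (hK : stalkIdeal K p = Ideal.span {MvPolynomial.eval c Φ}) (v : Γ(X, ⊤))
    (hϖ𝔪 : (X.presheaf.Γgerm p).hom v ∈ maximalIdeal (X.presheaf.stalk p))
    {Λ : Type u} [CommRing Λ] (θ : (X.presheaf.stalk p ⧸ Ideal.span (Set.range c)) ≃+* Λ)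
    (j : Fin r) (𝔔 : PrimeSpectrum (blowupAlgebra (Ideal.span (Set.range c)) (c j)))
    (χ : blowupAlgebra (Ideal.span (Set.range c)) (c j) →+* X'.presheaf.stalk x')
    (hχ : ∀ a, χ (algebraMap _ _ a) = ((X.presheaf.stalkCongr (Inseparable.of_eq hp)).inv ≫ τ.stalkMap x').hom a)
    (hloc : @IsLocalization.AtPrime _ _ (X'.presheaf.stalk x') _ χ.toAlgebra 𝔔.asIdeal _)
    (h𝔔 : 𝔔.asIdeal.comap (algebraMap _ (blowupAlgebra (Ideal.span (Set.range c)) (c j))) = maximalIdeal (X.presheaf.stalk p))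
    {ι : Type*} (β : ι → {l : Fin r // l ≠ j} → Λ) (b : ι → {l : Fin r // l ≠ j} → X.presheaf.stalk p)
    (hb : ∀ e l, θ (Ideal.Quotient.mk _ (b e l)) = β e l)
    (hreg : ∀ (𝔓 : Ideal (MvPolynomial {l : Fin r // l ≠ j} Λ ⧸ Ideal.span {MvPolynomial.map
        (θ.toRingHom.comp (Ideal.Quotient.mk (Ideal.span (Set.range c)))) (dehomogenize j Φ)})) [𝔓.IsPrime],
      Ideal.Quotient.mk _ (MvPolynomial.C (θ (Ideal.Quotient.mk _ ((X.presheaf.Γgerm p).hom v)))) ∈ 𝔓 →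
      (∀ e, ¬ ∀ l, Ideal.Quotient.mk _ (MvPolynomial.X l - MvPolynomial.C (β e l)) ∈ 𝔓) →
        IsRegularLocalRing (Localization.AtPrime 𝔓))
    (hpt : ∀ e, ¬ ∀ l, χ (blowupAlgebra.frac c j l.1) -
      ((X.presheaf.stalkCongr (Inseparable.of_eq hp)).inv ≫ τ.stalkMap x').hom (b e l) ∈ maximalIdeal (X'.presheaf.stalk x'))
    (hx' : x' ∈ (strictTransformIdeal τ J K ⊔ J.comap τ).support) :
    IsRegularLocalRing (X'.presheaf.stalk x' ⧸ stalkIdeal (strictTransformIdeal τ J K ⊔ J.comap τ) x') := by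
  -- as F3b′ (p535966), with the pointed ring-level transport
  obtain ⟨-, -, hC, hiff⟩ := stalkIdeal_carrierDelta_of_presentation K x' p hp hpJ c hcJ hc Φ hΦd hΦ hK j 𝔔 χ hχ hloc h𝔔
  subst hp
  letI := χ.toAlgebra
  haveI : IsLocalization.AtPrime (X'.presheaf.stalk x') 𝔔.asIdeal := hloc
  have hmem𝔔 : ∀ y, y ∈ 𝔔.asIdeal ↔ χ y ∈ maximalIdeal (X'.presheaf.stalk x') := fun y =>
    (IsLocalization.AtPrime.to_map_mem_maximal_iff (X'.presheaf.stalk x') 𝔔.asIdeal y).symm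
  have hG'𝔔 : MvPolynomial.aeval (blowupAlgebra.frac c j) Φ ∈ 𝔔.asIdeal := hiff.mp hx'
  have ht𝔔 : algebraMap _ (blowupAlgebra (Ideal.span (Set.range c)) (c j)) (c j) ∈ 𝔔.asIdeal := by
    rw [← Ideal.mem_comap, h𝔔]
    have h := (mem_support_iff_stalkIdeal_le J (τ x')).mp hpJ
    rw [← hcJ] at h
    exact h (Ideal.subset_span (Set.mem_range_self j))
  have h𝔞𝔔 : Ideal.span {MvPolynomial.aeval (blowupAlgebra.frac c j) Φ} ⊔
      Ideal.span {algebraMap _ (blowupAlgebra (Ideal.span (Set.range c)) (c j)) (c j)} ≤ 𝔔.asIdeal :=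
    sup_le ((Ideal.span_singleton_le_iff_mem _).mpr hG'𝔔) ((Ideal.span_singleton_le_iff_mem _).mpr ht𝔔)
  have hϖ𝔔 : algebraMap _ (blowupAlgebra (Ideal.span (Set.range c)) (c j)) ((X.presheaf.Γgerm (τ x')).hom v) ∈
      𝔔.asIdeal := by
    rw [← Ideal.mem_comap, h𝔔]; exact hϖ𝔪
  have hCmap : stalkIdeal (strictTransformIdeal τ J K ⊔ J.comap τ) x' =
      (Ideal.span {MvPolynomial.aeval (blowupAlgebra.frac c j) Φ} ⊔
        Ideal.span {algebraMap _ (blowupAlgebra (Ideal.span (Set.range c)) (c j)) (c j)}).map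
        (algebraMap (blowupAlgebra (Ideal.span (Set.range c)) (c j)) (X'.presheaf.stalk x')) := by
    rw [hC, Ideal.map_sup, Ideal.map_span, Ideal.map_span, Set.image_singleton, Set.image_singleton]
    rfl
  haveI : (𝔔.asIdeal.map (Ideal.Quotient.mk (Ideal.span {MvPolynomial.aeval (blowupAlgebra.frac c j) Φ} ⊔
      Ideal.span {algebraMap _ (blowupAlgebra (Ideal.span (Set.range c)) (c j)) (c j)}))).IsPrime :=
    Ideal.map_isPrime_of_surjective Ideal.Quotient.mk_surjective (by rw [Ideal.mk_ker]; exact h𝔞𝔔)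
  obtain ⟨ε₀, hε₀a, hε₀X⟩ := exists_quotient_coneTransform_sup_equiv c j hc Φ
  -- the point is not an excluded coordinate point: `𝔔` does not contain the whole family `c_l/c_j − b_e l`
  have hexcl : ∀ e, ¬ ∀ l, blowupAlgebra.frac c j l.1 -
      algebraMap _ (blowupAlgebra (Ideal.span (Set.range c)) (c j)) (b e l) ∈ 𝔔.asIdeal := by
    intro e hall
    apply hpt e
    intro l
    have := (hmem𝔔 _).mp (hall l)
    rwa [map_sub, hχ] at this
  have hreg' := isRegularLocalRing_localization_map_of_deltaCriterion_pointed c j Φ _ θ β hreg _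
    (algebraMap _ (blowupAlgebra (Ideal.span (Set.range c)) (c j))) (fun l => blowupAlgebra.frac c j l.1) ε₀ hε₀a
    (fun l => hε₀X l) 𝔔.asIdeal hϖ𝔔 h𝔞𝔔 b hb hexcl
  have hS := isRegularLocalRing_quotient_map_of_isLocalization (S := X'.presheaf.stalk x') 𝔔.asIdeal _ h𝔞𝔔 hreg'
  rw [← hCmap] at hS
  exact hS

set_option maxHeartbeats 400000 in -- the chart algebra `blowupAlgebra` is a subalgebra of a localisation: slow instance unification (cf. p535966)
/-- **Clause (v) on a good chart, POINTED** (res-L1-w45b-stub-2's `isRegularLocalRing_stalk_quotient_carrierDelta_of_generator` with the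
exclusions threaded through): if `τ♯(c_l)` generates the exceptional stalk at `x'`, the Δ-criterion holds on the chart `c_l` off the
coordinate families `β_e`, and for EVERY chart-`l` presentation `x'` is not a coordinate point `b_e`, then `𝒪_{X',x'} ⧸ (St K ⊔ E)_{x'}` is a
regular local ring. [cite: Matsumura1987, Thm. 14.2; StacksProject, Tag 0804] -/
theorem isRegularLocalRing_stalk_quotient_carrierDelta_of_generator_pointed [IsLocallyNoetherian X'] (hτ : IsBlowup τ J)
    (K : X.IdealSheafData) (x' : X') (p : X) (hp : τ x' = p) (hpJ : p ∈ (J.support : Set X)) {r : ℕ}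
    (c : Fin r → X.presheaf.stalk p) (hcJ : Ideal.span (Set.range c) = stalkIdeal J p)
    (hc : IsQuasiRegular c) [IsDomain (X.presheaf.stalk p ⧸ Ideal.span (Set.range c))]
    {d : ℕ} (Φ : MvPolynomial (Fin r) (X.presheaf.stalk p)) (hΦd : Φ.IsHomogeneous d)
    (hΦ : MvPolynomial.map (Ideal.Quotient.mk (Ideal.span (Set.range c))) Φ ≠ 0)
    (hK : stalkIdeal K p = Ideal.span {MvPolynomial.eval c Φ}) (v : Γ(X, ⊤))
    (hϖ𝔪 : (X.presheaf.Γgerm p).hom v ∈ maximalIdeal (X.presheaf.stalk p))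
    {Λ : Type u} [CommRing Λ] (θ : (X.presheaf.stalk p ⧸ Ideal.span (Set.range c)) ≃+* Λ) (l : Fin r)
    (hl : stalkIdeal (J.comap τ) x' = Ideal.span {((X.presheaf.stalkCongr (.of_eq hp)).inv ≫ τ.stalkMap x').hom (c l)})
    {ι : Type*} (β : ι → {l' : Fin r // l' ≠ l} → Λ) (b : ι → {l' : Fin r // l' ≠ l} → X.presheaf.stalk p)
    (hb : ∀ e l', θ (Ideal.Quotient.mk _ (b e l')) = β e l')
    (hreg : ∀ (𝔓 : Ideal (MvPolynomial {l' : Fin r // l' ≠ l} Λ ⧸ Ideal.span {MvPolynomial.map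
        (θ.toRingHom.comp (Ideal.Quotient.mk (Ideal.span (Set.range c)))) (dehomogenize l Φ)})) [𝔓.IsPrime],
      Ideal.Quotient.mk _ (MvPolynomial.C (θ (Ideal.Quotient.mk _ ((X.presheaf.Γgerm p).hom v)))) ∈ 𝔓 →
      (∀ e, ¬ ∀ l', Ideal.Quotient.mk _ (MvPolynomial.X l' - MvPolynomial.C (β e l')) ∈ 𝔓) →
        IsRegularLocalRing (Localization.AtPrime 𝔓))
    (hpt : ∀ (𝔔 : PrimeSpectrum (blowupAlgebra (Ideal.span (Set.range c)) (c l)))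
      (χ : blowupAlgebra (Ideal.span (Set.range c)) (c l) →+* X'.presheaf.stalk x'),
      (∀ a, χ (algebraMap _ _ a) = ((X.presheaf.stalkCongr (Inseparable.of_eq hp)).inv ≫ τ.stalkMap x').hom a) →
      @IsLocalization.AtPrime _ _ (X'.presheaf.stalk x') _ χ.toAlgebra 𝔔.asIdeal _ →
      ∀ e, ¬ ∀ l', χ (blowupAlgebra.frac c l l'.1) -
        ((X.presheaf.stalkCongr (Inseparable.of_eq hp)).inv ≫ τ.stalkMap x').hom (b e l') ∈ maximalIdeal (X'.presheaf.stalk x'))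
    (hx' : x' ∈ (strictTransformIdeal τ J K ⊔ J.comap τ).support) :
    IsRegularLocalRing (X'.presheaf.stalk x' ⧸ stalkIdeal (strictTransformIdeal τ J K ⊔ J.comap τ) x') := by
  obtain ⟨𝔔, χ, hχ, hloc, h𝔔⟩ := exists_prescribedChartPresentation_of_eq hτ x' hp c hcJ l hl
  exact isRegularLocalRing_stalk_quotient_carrierDelta_of_presentation_pointed K x' p hp hpJ c hcJ hc Φ hΦd hΦ hK v hϖ𝔪 θ l 𝔔 χ
    hχ hloc h𝔔 β b hb hreg (hpt 𝔔 χ hχ hloc) hx'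

end SchemeLevel

end Summit.ResolutionOfSingularities.ResolutionOfSingularities.Cruxes.EquisingularLiftNat.Sections

end
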